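import Literature.Analysis.FluidPDE.AncientMildCompactnessForced
import HarnessLib

/-!
# KNSS 2009, Lemma 6.1 with vanishing forcing and ASYMPTOTICALLY divergence-free fields

Analysis/FluidPDE proof file (theorems only; no definitions, no named facts, no `sorry`).

The tree's compactness engine `exists_oseenMild_limit_of_forced`
(`AncientMildCompactnessForced.lean`; Koch–Nadirashvili–Seregin–Šverák, Acta Math. 203 (2009) =
arXiv:0709.3599, Lemma 6.1 p. 11 with a vanishing right-hand side) asks that every field `w_k` have
weakly divergence-free slices. That hypothesis enters its proof at exactly one place — the weak
divergence-freeness of the LIMIT, obtained by passing to the limit in `∫⟪w_k(t), ∇θ⟫ = 0`. In a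
LOCALISED compactness argument the fields are truncations `χ_k w_k` of divergence-free fields by
cutoffs `χ_k ≡ 1` on balls `B(0, R_k)`, `R_k → ∞`; they are not divergence free, but
`∫⟪χ_k w_k(t), ∇θ⟫ = ∫⟪w_k(t), ∇θ⟫ = 0` as soon as `B(0, R_k) ⊇ supp θ`, so the integrals tend to `0`.
This file records the engine under that weaker hypothesis:

* `exists_oseenMild_limit_of_forced_asymptDivFree` — as `exists_oseenMild_limit_of_forced`, with
  `(hdiv : ∀ k, ∀ t ∈ (A_k, 0), IsWeaklyDivFree (w_k t))` replaced by
  `∫⟪w_k(t), ∇θ⟫ → 0` as `k → ∞` for every `t < 0` and every test function `θ`; same conclusions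
  (the limit `W` is continuous, weakly divergence free, bounded by the profile, UNFORCED Oseen-mild,
  and the limit of a subsequence uniformly on slab pieces / pointwise / slice-locally-uniformly).
  The proof is the tree's, verbatim, except for Step 4a (`tendsto_nhds_unique` of the two limits);
* `exists_oseenMild_limit_of_forced_asymptDivFree_const` — constant profiles.

Consumer: the LOCALISED zoom with force at a prescribed singular point of a Clay blow-up
(`Summits/NavierStokesRegularity/FluidComputer/ClayBlowupLocalZoom*.lean`, cell `ns-blowup`, seat
ecbridge-2 g11), where the truncated zooms satisfy a GLOBAL perturbed Oseen identity whose
perturbation is defined by the identity itself and bounded by the energy-paid far-field estimates.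

## Mathlib / tree search

Tree: `exists_oseenMild_limit_of_forced` and everything it uses (`exists_holder_quarter_of_oseenMild_perturbed`,
`exists_strictMono_tendstoUniformlyOn_of_bound`, `continuousOn_slab_of_tendstoUniformlyOn`,
`tendsto_of_tendstoUniformlyOn_slabPiece`, `tendstoLocallyUniformly_slice_of_tendstoUniformlyOn_slabPiece`,
`tendsto_heatExtension_of_tendsto_of_bound`, `tendsto_oseenDuhamel_of_tendsto_of_bound`).
`lean search 'asympt.*DivFree|oseenMild_limit'`: no asymptotic variant in the tree.

## References

* G. Koch, N. Nadirashvili, G. Seregin, V. Šverák, *Liouville theorems for the Navier–Stokes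
  equations and applications*, Acta Math. 203 (2009) 83–105 = arXiv:0709.3599: §3 (3.4)–(3.8),
  Lemma 4.1 (p. 8), Lemma 6.1 (p. 11), proof of Thm. 6.2 (p. 13). [KochNadirashviliSereginSverak2009]
-/

noncomputable section

open MeasureTheory Set Function Filter TopologicalSpace Metric
open _root_.Topology
open scoped RealInnerProductSpace NNReal ENNReal

namespace Literature.Analysis.FluidPDE

variable {E : Type*} [NormedAddCommGroup E] [InnerProductSpace ℝ E] [FiniteDimensional ℝ E]
  [MeasurableSpace E] [BorelSpace E]

/-- **KNSS 2009, Lemma 6.1 with vanishing forcing, for ASYMPTOTICALLY divergence-free fields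
(monotone profiles).** Let `w_k : ℝ → E → E` be continuous on the open slabs `(A_k, 0) × E` with
`A_k → −∞`, satisfying the PERTURBED Oseen identity
`w_k(t) = e^{(t−s)Δ}w_k(s) − B¹_s(w_k, w_k)(t) + G_k(s,t)` pointwise for all `A_k < s < t < 0`, the
bound `‖w_k(τ, x)‖ ≤ β(τ)` for `A_k < τ < 0` (`β` monotone on `(−∞, 0)`), with perturbations
`‖G_k(s,t)(x)‖ ≤ γ(t)√(t − s)` for `0 < t − s ≤ 1` (`γ ≥ 0` monotone on `(−∞, 0)`) tending to `0`
as `k → ∞` at every `s < t < 0`, `x`, and such that `∫⟪w_k(t), ∇θ⟫ → 0` for every `t < 0` and every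
test function `θ`. Then there are a subsequence `φ` and a field `W`, continuous on `(−∞, 0) × E`,
with weakly divergence-free slices, `‖W(t, x)‖ ≤ β(t)`, satisfying the UNFORCED Oseen identity for
all `s < t < 0`, such that `w_{φ(j)} → W` uniformly on every slab piece
`[−(n+2), −1/(n+2)] × B̄(0, n+2)`, pointwise at every point of the open slab, and locally uniformly
on every negative time slice. Proof: the tree's `exists_oseenMild_limit_of_forced` verbatim except
Step 4a. [cite: KochNadirashviliSereginSverak2009, Lemma 6.1 (arXiv p. 11) and proof of Thm 6.2 (p. 13)] -/
theorem exists_oseenMild_limit_of_forced_asymptDivFree {A : ℕ → ℝ} {w : ℕ → ℝ → E → E}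
    {G : ℕ → ℝ → ℝ → E → E} {β γ : ℝ → ℝ}
    (hAlim : Tendsto A atTop atBot) (hβ : MonotoneOn β (Iio 0)) (hγ : MonotoneOn γ (Iio 0))
    (hγ0 : ∀ τ < 0, 0 ≤ γ τ)
    (hcont : ∀ k, ContinuousOn (uncurry (w k)) (Ioo (A k) 0 ×ˢ univ))
    (hdiv : ∀ t < 0, ∀ θ : E → ℝ, FunctionSpaces.IsTestFunctionOn (⊤ : Opens E) θ →
      Tendsto (fun k => ∫ x, ⟪w k t x, gradient θ x⟫) atTop (𝓝 0))
    (hmild : ∀ k, ∀ s t : ℝ, A k < s → s < t → t < 0 → ∀ x,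
      w k t x = UnboundedOperators.heatExtension (w k s) (t - s) x -
        oseenDuhamel 1 s (w k) (w k) t x + G k s t x)
    (hGb : ∀ k, ∀ s t : ℝ, A k < s → s < t → t < 0 → t - s ≤ 1 → ∀ x,
      ‖G k s t x‖ ≤ γ t * Real.sqrt (t - s))
    (hGlim : ∀ s t : ℝ, s < t → t < 0 → ∀ x, Tendsto (fun k => G k s t x) atTop (𝓝 0))
    (hbdd : ∀ k, ∀ τ ∈ Ioo (A k) 0, ∀ x, ‖w k τ x‖ ≤ β τ) :
    ∃ (φ : ℕ → ℕ) (W : ℝ → E → E), StrictMono φ ∧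
      ContinuousOn (uncurry W) (Iio 0 ×ˢ univ) ∧
      (∀ t < 0, IsWeaklyDivFree (W t)) ∧
      (∀ t < 0, ∀ x, ‖W t x‖ ≤ β t) ∧
      (∀ s t : ℝ, s < t → t < 0 → ∀ x,
        W t x = UnboundedOperators.heatExtension (W s) (t - s) x - oseenDuhamel 1 s W W t x) ∧
      (∀ n : ℕ, TendstoUniformlyOn (fun j => uncurry (w (φ j))) (uncurry W) atTop
        (Icc (-((n : ℝ) + 2)) (-(1 / ((n : ℝ) + 2))) ×ˢ closedBall (0 : E) ((n : ℝ) + 2))) ∧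
      (∀ t < 0, ∀ x, Tendsto (fun j => w (φ j) t x) atTop (𝓝 (W t x))) ∧
      (∀ t < 0, TendstoLocallyUniformly (fun j => w (φ j) t) (W t) atTop) := by
  -- ## Step 1: per-`k` facts
  have hslice : ∀ k, ∀ t ∈ Ioo (A k) 0, Continuous (w k t) := fun k t ht =>
    (hcont k).comp_continuous (Continuous.prodMk_right t) fun x => ⟨ht, mem_univ x⟩
  -- monotonicity of the profiles: `β τ ≤ β (-δ)`, `γ τ ≤ γ (-δ)` for `τ ≤ -δ < 0`
  have hβle : ∀ {δ τ : ℝ}, 0 < δ → τ ≤ -δ → β τ ≤ β (-δ) := fun {δ τ} hδ hτ =>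
    hβ (show τ ∈ Iio 0 from mem_Iio.2 (by linarith)) (show -δ ∈ Iio 0 from mem_Iio.2 (by linarith))
      hτ
  have hγle : ∀ {δ τ : ℝ}, 0 < δ → τ ≤ -δ → γ τ ≤ γ (-δ) := fun {δ τ} hδ hτ =>
    hγ (show τ ∈ Iio 0 from mem_Iio.2 (by linarith)) (show -δ ∈ Iio 0 from mem_Iio.2 (by linarith))
      hτ
  -- eventually the slice lies in the domain
  have hdomA : ∀ t : ℝ, ∀ᶠ k in atTop, A k < t := fun t => hAlim.eventually (eventually_lt_atBot t)
  -- nonnegativity of the profile at negative times (the domains are eventually nonempty)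
  have hβ0 : ∀ τ < 0, 0 ≤ β τ := fun τ hτ => by
    obtain ⟨k, hk⟩ := (hdomA τ).exists
    exact (norm_nonneg _).trans (hbdd k τ ⟨hk, hτ⟩ 0)
  -- ## Step 2: the uniform Hölder modulus on the slab pieces (perturbed form)
  obtain ⟨K₀, hK₀, hHold⟩ := exists_holder_quarter_of_oseenMild_perturbed (E := E)
  -- bounds and modulus constants on the `n`-th piece
  set R : ℕ → ℝ := fun n => β (-(1 / ((n : ℝ) + 2))) with hR
  have hR0 : ∀ n, 0 ≤ R n := fun n => hβ0 _ (by rw [neg_lt_zero]; positivity)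
  set N : ℕ → ℝ := fun n => γ (-(1 / ((n : ℝ) + 2))) with hN
  have hN0 : ∀ n, 0 ≤ N n := fun n => hγ0 _ (by rw [neg_lt_zero]; positivity)
  set V : ℕ → ℝ × E → E := fun k z => w k z.1 z.2 with hV
  -- the slab pieces `[−(n+2), −1/(n+2)] × B̄(0, n+2)` of `HolderExtraction.lean`
  set T : ℕ → Set (ℝ × E) := fun n =>
    Icc (-((n : ℝ) + 2)) (-(1 / ((n : ℝ) + 2))) ×ˢ closedBall (0 : E) ((n : ℝ) + 2) with hT
  have hVn : ∀ n : ℕ, ∀ᶠ k in atTop, ContinuousOn (V k) (T n) ∧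
      (∀ z ∈ T n, ‖V k z‖ ≤ R n) ∧
      ∀ z ∈ T n, ∀ z' ∈ T n,
        dist (V k z) (V k z') ≤ K₀ * (R n + R n ^ 2 + N n) * dist z z' ^ (1 / 4 : ℝ) := by
    intro n
    have hn2 : (0 : ℝ) < (n : ℝ) + 2 := by positivity
    have hδ : (0 : ℝ) < 1 / ((n : ℝ) + 2) := by positivity
    filter_upwards [hdomA (-((n : ℝ) + 3))] with k hk
    -- the window `[a, b] = [−(n+3), −1/(n+2)] ⊂ (A k, 0)`
    set a : ℝ := -((n : ℝ) + 3) with ha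
    set b : ℝ := -(1 / ((n : ℝ) + 2)) with hb
    have hb0 : b < 0 := by rw [hb]; linarith
    have hIcc0 : ∀ t ∈ Icc a b, t ∈ Ioo (A k) 0 := fun t ht =>
      ⟨hk.trans_le ht.1, ht.2.trans_lt hb0⟩
    have hbR : ∀ t ∈ Icc a b, ∀ x, ‖w k t x‖ ≤ R n := fun t ht x =>
      (hbdd k t (hIcc0 t ht) x).trans (hβle hδ (by rw [hb] at ht; exact ht.2))
    have hbG : ∀ s t : ℝ, a ≤ s → s < t → t ≤ b → t - s ≤ 1 → ∀ x,
        ‖G k s t x‖ ≤ N n * Real.sqrt (t - s) := fun s t has hst htb hlag x =>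
      (hGb k s t (hk.trans_le has) hst (htb.trans_lt hb0) hlag x).trans
        (mul_le_mul_of_nonneg_right (hγle hδ (by rw [hb] at htb; exact htb)) (Real.sqrt_nonneg _))
    have hmod := hHold (hR0 n) (hN0 n) (fun t ht => hslice k t (hIcc0 t ht)) hbR
      (fun s t has hst htb x => hmild k s t (hk.trans_le has) hst (htb.trans_lt hb0) x) hbG
    have hpiece : ∀ z ∈ T n, z.1 ∈ Icc (a + 1) b := fun z hz => by
      obtain ⟨⟨h1, h2⟩, -⟩ := mem_slabPiece.1 hz
      exact ⟨by rw [ha]; linarith, by rw [hb]; exact h2⟩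
    refine ⟨?_, fun z hz => ?_, fun z hz z' hz' => ?_⟩
    · refine (hcont k).mono fun z hz => ⟨?_, mem_univ _⟩
      have h := hpiece z hz
      exact hIcc0 z.1 ⟨by linarith [h.1], h.2⟩
    · have h := hpiece z hz
      exact hbR z.1 ⟨by linarith [h.1], h.2⟩ z.2
    · have h := hmod z'.1 (hpiece z' hz') z.1 (hpiece z hz) z'.2 z.2
      rw [dist_eq_norm, Prod.dist_eq, Real.dist_eq, dist_eq_norm]
      exact h
  -- ## Step 3: extraction
  obtain ⟨φ, hφ, W₀, hW₀⟩ := exists_strictMono_tendstoUniformlyOn_of_bound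
    (fun n => isCompact_slabPiece (E := E) n)
    (fun n => mul_nonneg hK₀.le (add_nonneg (add_nonneg (hR0 n) (sq_nonneg _)) (hN0 n)))
    (fun _ => by norm_num) hVn
  have hφt : Tendsto φ atTop atTop := hφ.tendsto_atTop
  set W : ℝ → E → E := fun t x => W₀ (t, x) with hWdef
  have hVφ : ∀ n, ∀ᶠ j in atTop, ContinuousOn (V (φ j)) (T n) := fun n =>
    (hφt.eventually (hVn n)).mono fun j hj => hj.1
  -- continuity of the limit on the open slab
  have hWc : ContinuousOn (uncurry W) (Iio 0 ×ˢ univ) := by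
    have h := continuousOn_slab_of_tendstoUniformlyOn hVφ hW₀
    exact h.congr fun z _ => rfl
  -- pointwise convergence at negative times
  have hpt : ∀ t < 0, ∀ x, Tendsto (fun j => w (φ j) t x) atTop (𝓝 (W t x)) := fun t ht x =>
    tendsto_of_tendstoUniformlyOn_slabPiece hW₀ ht x
  -- eventually the slice lies in the domain
  have hdom : ∀ t : ℝ, ∀ᶠ j in atTop, A (φ j) < t := fun t =>
    (hAlim.comp hφt).eventually (eventually_lt_atBot t)
  refine ⟨φ, W, hφ, hWc, fun t ht => ?_, fun t ht x => ?_, fun s t hst ht x => ?_, ?_, hpt,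
    fun t ht => ?_⟩
  · -- ## Step 4a: weak divergence-freeness of the limit slices
    intro θ hθ
    have hθ1 : ContDiff ℝ 1 θ := contDiff_infty.1 hθ.contDiff 1
    have hgc : HasCompactSupport (gradient θ) := by
      have : gradient θ = (fun L => (InnerProductSpace.toDual ℝ E).symm L) ∘ fderiv ℝ θ := rfl
      rw [this]
      exact (hθ.hasCompactSupport.fderiv (𝕜 := ℝ)).comp_left (by simp)
    set Mt : ℝ := β t with hMt
    have hθi : Integrable (fun x => Mt * ‖gradient θ x‖) volume :=
      (((continuous_gradient_of_contDiff hθ1).integrable_of_hasCompactSupport hgc).norm).const_mul Mt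
    have hlimθ : Tendsto (fun j => ∫ x, ⟪w (φ j) t x, gradient θ x⟫) atTop
        (𝓝 (∫ x, ⟪W t x, gradient θ x⟫)) := by
      refine tendsto_integral_filter_of_dominated_convergence (fun x => Mt * ‖gradient θ x‖)
        ?_ ?_ hθi (Eventually.of_forall fun x => (hpt t ht x).inner tendsto_const_nhds)
      · filter_upwards [hdom t] with j hj
        exact ((hslice (φ j) t ⟨hj, ht⟩).inner
          (continuous_gradient_of_contDiff hθ1)).aestronglyMeasurable
      · filter_upwards [hdom t] with j hj
        exact Eventually.of_forall fun x => (norm_inner_le_norm _ _).trans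
          (mul_le_mul_of_nonneg_right (hbdd (φ j) t ⟨hj, ht⟩ x) (norm_nonneg _))
    have hzero : Tendsto (fun j => ∫ x, ⟪w (φ j) t x, gradient θ x⟫) atTop (𝓝 0) :=
      (hdiv t ht θ hθ).comp hφt
    exact tendsto_nhds_unique hlimθ hzero
  · -- ## Step 4b: the bound `‖W‖ ≤ β`
    refine le_of_tendsto (hpt t ht x).norm ?_
    filter_upwards [hdom t] with j hj
    exact hbdd (φ j) t ⟨hj, ht⟩ x
  · -- ## Step 5: the Oseen identity in the limit — the perturbation drops out
    have hs0 : s < 0 := hst.trans ht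
    obtain ⟨k₀, hk₀⟩ := eventually_atTop.1 (hdom s)
    set u : ℕ → ℝ → E → E := fun j => w (φ (j + k₀)) with hu
    have hAu : ∀ j, A (φ (j + k₀)) < s := fun j => hk₀ _ (Nat.le_add_left _ _)
    have hshift : Tendsto (fun j => j + k₀) atTop atTop := tendsto_add_atTop_nat k₀
    -- bound on `(s, t)`
    set M₀ : ℝ := β t with hM₀
    have hM₀0 : 0 ≤ M₀ := hβ0 t ht
    have huM : ∀ j, ∀ τ ∈ Ioo s t, ∀ y, ‖u j τ y‖ ≤ M₀ := fun j τ hτ y =>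
      (hbdd _ τ ⟨(hAu j).trans hτ.1, hτ.2.trans ht⟩ y).trans
        (hβ (show τ ∈ Iio 0 from hτ.2.trans ht) (show t ∈ Iio 0 from ht) hτ.2.le)
    -- measurability
    have hum : ∀ j, AEStronglyMeasurable (uncurry (u j))
        ((volume : Measure (ℝ × E)).restrict (Ioo s t ×ˢ univ)) :=
      fun j => ((hcont _).mono (prod_mono
        (fun τ hτ => ⟨(hAu j).trans hτ.1, hτ.2.trans ht⟩) Subset.rfl)).aestronglyMeasurable
          (measurableSet_Ioo.prod MeasurableSet.univ)
    have hWm : AEStronglyMeasurable (uncurry W)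
        ((volume : Measure (ℝ × E)).restrict (Ioo s t ×ˢ univ)) :=
      (hWc.mono (prod_mono (fun τ hτ => hτ.2.trans ht) Subset.rfl)).aestronglyMeasurable
        (measurableSet_Ioo.prod MeasurableSet.univ)
    -- pointwise convergence along the shifted subsequence
    have hptu : ∀ τ < 0, ∀ y, Tendsto (fun j => u j τ y) atTop (𝓝 (W τ y)) := fun τ hτ y =>
      (hpt τ hτ y).comp hshift
    -- the Duhamel term
    have hD : Tendsto (fun j => oseenDuhamel 1 s (u j) (u j) t x) atTop
        (𝓝 (oseenDuhamel 1 s W W t x)) :=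
      tendsto_oseenDuhamel_of_tendsto_of_bound one_pos hM₀0 hst hum hWm huM
        (fun τ hτ y => hptu τ (hτ.2.trans ht) y) x
    -- the caloric term
    have hH : Tendsto (fun j => UnboundedOperators.heatExtension (u j s) (t - s) x) atTop
        (𝓝 (UnboundedOperators.heatExtension (W s) (t - s) x)) := by
      refine tendsto_heatExtension_of_tendsto_of_bound (M := β s)
        (fun j => (hslice _ s ⟨hAu j, hs0⟩).aestronglyMeasurable)
        (fun j z => hbdd _ s ⟨hAu j, hs0⟩ z) (hptu s hs0) (sub_pos.2 hst) x
    -- the perturbation vanishes along the shifted subsequence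
    have hGu : Tendsto (fun j => G (φ (j + k₀)) s t x) atTop (𝓝 0) :=
      (hGlim s t hst ht x).comp (hφt.comp hshift)
    -- the identity for each `j` and the limit
    have hid : (fun j => u j t x) = fun j =>
        UnboundedOperators.heatExtension (u j s) (t - s) x - oseenDuhamel 1 s (u j) (u j) t x +
          G (φ (j + k₀)) s t x :=
      funext fun j => hmild _ s t (hAu j) hst ht x
    have hlim2 : Tendsto (fun j => u j t x) atTop
        (𝓝 (UnboundedOperators.heatExtension (W s) (t - s) x - oseenDuhamel 1 s W W t x)) := by
      rw [hid]
      simpa using (hH.sub hD).add hGu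
    exact tendsto_nhds_unique (hptu t ht x) hlim2
  · -- ## Step 3': uniform convergence on the pieces (the statement of the extraction)
    intro n
    exact (hW₀ n).congr (Eventually.of_forall fun j => eqOn_refl _ _)
  · -- ## Step 3'': slice-wise locally uniform convergence
    exact tendstoLocallyUniformly_slice_of_tendstoUniformlyOn_slabPiece hW₀ ht

/-- **Constant profiles**: bounded (`‖w_k‖ ≤ C`) forced Oseen-mild fields on `(A_k, 0) × E`,
`A_k → −∞`, asymptotically divergence free, whose perturbations are uniformly `O(√lag)`
(`‖G_k(s,t)(x)‖ ≤ N√(t − s)` for lags `≤ 1`) and tend to `0`, have a subsequence converging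
(uniformly on the slab pieces, pointwise, slice-locally-uniformly) to a bounded, weakly
divergence-free, UNFORCED Oseen-mild field `W`, `‖W‖ ≤ C`.
[cite: KochNadirashviliSereginSverak2009, Lemma 6.1 (arXiv p. 11)] -/
theorem exists_oseenMild_limit_of_forced_asymptDivFree_const {A : ℕ → ℝ} {w : ℕ → ℝ → E → E}
    {G : ℕ → ℝ → ℝ → E → E} {C N : ℝ} (hN : 0 ≤ N)
    (hAlim : Tendsto A atTop atBot)
    (hcont : ∀ k, ContinuousOn (uncurry (w k)) (Ioo (A k) 0 ×ˢ univ))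
    (hdiv : ∀ t < 0, ∀ θ : E → ℝ, FunctionSpaces.IsTestFunctionOn (⊤ : Opens E) θ →
      Tendsto (fun k => ∫ x, ⟪w k t x, gradient θ x⟫) atTop (𝓝 0))
    (hmild : ∀ k, ∀ s t : ℝ, A k < s → s < t → t < 0 → ∀ x,
      w k t x = UnboundedOperators.heatExtension (w k s) (t - s) x -
        oseenDuhamel 1 s (w k) (w k) t x + G k s t x)
    (hGb : ∀ k, ∀ s t : ℝ, A k < s → s < t → t < 0 → t - s ≤ 1 → ∀ x,
      ‖G k s t x‖ ≤ N * Real.sqrt (t - s))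
    (hGlim : ∀ s t : ℝ, s < t → t < 0 → ∀ x, Tendsto (fun k => G k s t x) atTop (𝓝 0))
    (hbdd : ∀ k, ∀ τ ∈ Ioo (A k) 0, ∀ x, ‖w k τ x‖ ≤ C) :
    ∃ (φ : ℕ → ℕ) (W : ℝ → E → E), StrictMono φ ∧
      ContinuousOn (uncurry W) (Iio 0 ×ˢ univ) ∧
      (∀ t < 0, IsWeaklyDivFree (W t)) ∧
      (∀ t < 0, ∀ x, ‖W t x‖ ≤ C) ∧
      (∀ s t : ℝ, s < t → t < 0 → ∀ x,
        W t x = UnboundedOperators.heatExtension (W s) (t - s) x - oseenDuhamel 1 s W W t x) ∧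
      (∀ n : ℕ, TendstoUniformlyOn (fun j => uncurry (w (φ j))) (uncurry W) atTop
        (Icc (-((n : ℝ) + 2)) (-(1 / ((n : ℝ) + 2))) ×ˢ closedBall (0 : E) ((n : ℝ) + 2))) ∧
      (∀ t < 0, ∀ x, Tendsto (fun j => w (φ j) t x) atTop (𝓝 (W t x))) ∧
      (∀ t < 0, TendstoLocallyUniformly (fun j => w (φ j) t) (W t) atTop) :=
  exists_oseenMild_limit_of_forced_asymptDivFree (β := fun _ => C) (γ := fun _ => N) hAlim
    monotoneOn_const monotoneOn_const (fun _ _ => hN) hcont hdiv hmild hGb hGlim hbdd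

end Literature.Analysis.FluidPDE

end
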